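import Literature.MathematicalPhysics.QuantumFieldTheory.MatrixTreeTheorem
import Literature.MathematicalPhysics.QuantumFieldTheory.HeppSectorDominance
import HarnessLib

/-!
# The lower half of Hepp's bound: `H(G) · |ST_G|^{-2} ≤ P(G)` (Panzer 2022, eq. (1.6))

Topic `MathematicalPhysics/QuantumFieldTheory`. `HeppBound.lean` states Panzer's Hepp bound `H(G)`
(`graphUnitHeppBound`, Def. 2.4 at unit indices in `D = 4`) and the period `P(G)` (`graphPeriod`, eq. (1.2) in
the chart `x_N = 1`); `HeppBoundProofs.lean` PROVES the upper half `P(G) ≤ H(G)` of eq. (1.6)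
(`Panzer2022_period_le_hepp_holds`) and lists the lower half as «deliberately NOT here … (needs the matrix-tree
count `|ST_G| = Ψ_G(1,…,1)`)». With the matrix-tree theorem typed (`MatrixTreeTheorem.lean`:
`kirchhoffEval_eq_sum_spanningTrees`, `Ψ_E(x) = Σ_{T spanning tree} Π_{e∉T} x_e`) and the sector combinatorics
of `HeppSectorDominance.lean` (dominance of Kruskal's tree, eq. (∗); sectors overlap only in ties), this file
PROVES the lower half (no named fact, no definition, no `sorry`):

  `graphUnitHeppBound_div_card_sq_le_graphPeriod : H(G) / |ST_G|² ≤ P(G)` for connected primitive-divergent `G`,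

with `|ST_G| = #(univ.filter (IsSpanningTree E))` (classical decidability, as in `MatrixTreeTheorem.lean`).

SOURCE (held, `paper:arxiv-1908.09820`): E. Panzer, *Hepp's bound for Feynman graphs and matroids*, AIHPD 10
(2023) 31–119 [Panzer2022], §1, chunk p0003:L76–L80 VERBATIM: "It is indeed a bound on the period, since we
have `Ψ^trop_G ≤ Ψ_G ≤ Ψ^trop_G · |ST_G|` and therefore  `H(G) · |ST_G|^{−D/2} ≤ P(G) ≤ H(G)`. (1.6)";
§2.2, chunk p0007:L64–L76: "within every sector `H_σ`, there is a unique spanning tree `T_σ ∈ ST_G` that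
dominates all others, i.e. the function `Ψ^trop_G` is given by a fixed monomial inside the sector:
`Ψ^trop_G(x)|_{x∈H_σ} = Π_{e∉T_σ} x_e` (∗) … following Kruskal this spanning tree is uniquely determined by
the total order `σ` of the weights: **Lemma 2.8** (Kruskal's greedy algorithm)"; §2.3, chunk p0009:L58:
"recall that `max_T |γ ∩ T| = rank γ`".

## Proof (eq. (1.6) lower half, `D = 4`, in the fixed affine chart `x_N = 1`, mirroring `HeppBoundProofs.lean`)

1. (`prod_rpow_le_card_sq_div_sq_kirchhoffEval_sorted`) On the closed Hepp sector
   `y_0 ≤ y_1 ≤ ⋯ ≤ y_{N-1}`, Kruskal's greedy tree `T` (`HeppSectorDominance.exists_greedy_isSpanningTree`: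
   `#(T ∩ G_k) = rk G_k` for every prefix `G_k`) dominates every spanning tree `T'`
   (`HeppSectorDominance.IsSpanningTree.prod_compl_le_of_greedy`, eq. (∗): `Π_{e∉T'} y_e ≤ Π_{e∉T} y_e`);
   summing the matrix-tree expansion, `Ψ_E(y) ≤ |ST_E| · Π_{e∉T} y_e`, i.e.
   `Π_k y_k^{ω(G_{k+1}) − ω(G_k) − 1} = (Π_{e∉T} y_e)^{−2} ≤ |ST_E|² / Ψ_E(y)²` (the upper half used
   `Ψ_E(y) ≥ Π_{e∉T} y_e` at this point); transported to any ordering `σ` by relabelling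
   (`prod_rpow_le_card_sq_div_sq_kirchhoffEval`; the spanning-tree count is relabelling-invariant).
2. (`sector_le_ofReal_card_sq_mul_graphPeriodIntegrand`) Hence the sector function `L 0 x · U n x` of the
   ordering sorting `(x, 1)` (the integrand of `HeppBoundProofs.lintegral_sector_eq`, whose integral is
   `Π_k ω(G^σ_k)⁻¹`) is at most `|ST_E|² / Ψ_E(x,1)²`.
3. (`HeppSectorDominance.mem_openOrthant_and_eq_ofFn_sort_of_sector_ne_zero`,
   `HeppSectorDominance.volume_setOf_not_injective_snoc`) The sector functions of DIFFERENT orderings overlap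
   only where two weights of `(x, 1)` tie — Lebesgue-null — because a sector function vanishes unless
   `0 < y_{l_0} ≤ ⋯ ≤ y_{l_n}`, and a tie-free monotone arrangement is the sorting permutation. So a.e.
   `Σ_l (L 0 · U n)_l(x) ≤ |ST_E|² · 1_{x>0} / Ψ_E(x,1)²`.
4. (`graphUnitHeppBound_le_card_sq_mul_graphPeriod`; corollaries `graphPeriod_mem_Icc` — both halves —,
   `graphUnitHeppBound_pos`, `graphPeriod_pos`) Integrating, `H(G) = Σ_l Π_k ω(G^l_k)⁻¹`
   (`cast_graphUnitHeppBound`) `≤ |ST_E|² · ∫_{x>0} dx/Ψ² = |ST_E|² · P(G)`, the last step by absolute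
   convergence of the period (`graphPeriod_convergent_of_isPrimitiveDivergent_holds`).

Also typed, as printed: **`exists_isSpanningTree_dominating`** — `Ψ^trop_G ≤ Ψ_G ≤ Ψ^trop_G · |ST_G|`
with the tropical maximum ATTAINED: for a connected edge list and any positive weights `y` there is a spanning
tree `T` with `Π_{e∉T'} y_e ≤ Π_{e∉T} y_e` for every spanning tree `T'` (so `Π_{e∉T} y_e = Ψ^trop_G(y)`, eq. (1.4)
/ §2.2 eq. (∗)) and `Π_{e∉T} y_e ≤ Ψ_G(y) ≤ |ST_G| · Π_{e∉T} y_e` (sorted case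
`exists_isSpanningTree_dominating_sorted`: `T` is Kruskal's greedy tree, Lemma 2.8), and §2.2 eq. (∗) ITSELF with Borinsky's `trop`
(`MatrixTreeTheorem.lean` § Tropical): **`exists_isSpanningTree_trop_eq_prod_compl`** — for every ordering `σ`
there is a spanning tree `T_σ`, depending on `σ` only, with `Ψ^tr_E(y) = Π_{e∉T_σ} y_e` for all positive `y`
sorted along `σ` ("within every sector `H_σ` … `Ψ^trop_G` is given by a fixed monomial").

No definitions are introduced; the per-ordering data are the `rfl`-instantiated hypotheses of
`HeppSectorIntegral.lean` / `HeppBoundProofs.lean`. Deliberately NOT here: general indices and dimensions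
(`|ST_G|^{−D/2}`, Mellin form (1.5), Prop. 2.9), the tropical function `Ψ^trop` as a definition, sharpness.

## References

* [Panzer2022] E. Panzer, AIHPD 10 (2023) 31–119, doi:10.4171/aihpd/126, arXiv:1908.09820 — §1 eq. (1.6),
  §2.2 eq. (∗) and Lemma 2.8, §2.3 (rank; proof of Lemma 2.16), Def. 2.4.
* [Brown2009FeynmanPeriods] F. Brown, arXiv:0910.0114, Def. 13 / Prop. 21 (`Ψ_G = Σ_T Π_{e∉T} x_e = det M_G`,
  via `MatrixTreeTheorem.lean`).
-/

noncomputable section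

open Matrix Finset MeasureTheory ENNReal Function
open Literature.Combinatorics.Matroid

namespace Literature.MathematicalPhysics.QuantumFieldTheory

/-! ### `Ψ ≤ |ST_G| · Ψ^trop` along an ordering -/

section Trop

variable {N V : ℕ}

open scoped Classical in
/-- **`Ψ ≤ |ST_G| · Ψ^trop`, sorted case.** For a connected edge list and positive weights sorted
along the labelling, `y₀ ≤ y₁ ≤ ⋯`, `Π_k y_k^{D(k+1) - D(k) - 1} ≤ |ST_E|² / Ψ_E(y)²` with
`D j = j - 2 h₁(first j edges)`: the product is `(Π_{e∉T} y_e)^{-2}` for Kruskal's greedy tree `T`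
(`exists_greedyRows`), every spanning-tree monomial `Π_{e∉T'} y_e` of `Ψ_E = Σ_{T'} Π_{e∉T'} y_e`
(matrix-tree theorem) is at most the greedy one (`#(T' ∩ G_k) ≤ rk G_k = #(T ∩ G_k)`), so
`Ψ_E(y) ≤ |ST_E| · Π_{e∉T} y_e`. [cite: Panzer2022, §1 eq. (1.6) (Ψ_G ≤ Ψ^trop_G · |ST_G|) with Lemma 2.8] -/
theorem prod_rpow_le_card_sq_div_sq_kirchhoffEval_sorted
    (E : Fin N → Fin (V + 1) × Fin (V + 1))
    (hc : IsConnectedEdgeList E) (y : Fin N → ℝ) (hy : ∀ e, 0 < y e) (hmono : Monotone y)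
    (D : ℕ → ℝ)
    (hD : ∀ j, D j = (j : ℝ) - 2 * (loopNumber E (univ.filter fun i : Fin N => (i : ℕ) < j) : ℝ)) :
    ∏ k : Fin N, y k ^ (D ((k : ℕ) + 1) - D k - 1) ≤
      ((univ.filter (IsSpanningTree E)).card : ℝ) ^ 2 / kirchhoffEval E y ^ 2 := by
  classical
  -- Kruskal's greedy tree `T` and its prefix counts
  set v : Fin N → (Fin V → ℚ) := fun e => reducedIncidence ℚ E e with hv
  obtain ⟨T, hli, hTcount⟩ := exists_greedyRows ℚ v
  have hcount : ∀ m, (T ∩ univ.filter fun k : Fin N => (k : ℕ) < m).card =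
      edgeRank E (univ.filter fun k : Fin N => (k : ℕ) < m) := fun m => by
    rw [hTcount, edgeRank_eq_finrank_span]
  have hc' : (reducedIncidence ℚ E).rank = V := hc
  have hTcard : T.card = V := by
    have := hcount N
    rwa [ltFilter_of_le le_rfl, Finset.inter_univ, edgeRank_univ, hc'] at this
  -- every spanning-tree monomial is at most the greedy one
  have hmaj : ∀ T' ∈ univ.filter (IsSpanningTree E), ∏ e ∈ T'ᶜ, y e ≤ ∏ e ∈ Tᶜ, y e := by
    intro T' hT'
    rw [Finset.mem_filter_univ] at hT'
    exact hT'.prod_compl_le_of_greedy hTcard hcount y hy hmono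
  -- `Ψ ≤ |ST| · Π_{e∉T} y_e` and `Ψ > 0`
  have hP : 0 < ∏ e ∈ Tᶜ, y e := prod_pos fun e _ => hy e
  have hΨle : kirchhoffEval E y ≤ ((univ.filter (IsSpanningTree E)).card : ℝ) * ∏ e ∈ Tᶜ, y e := by
    rw [kirchhoffEval_eq_sum_spanningTrees]
    calc ∑ T' ∈ univ.filter (IsSpanningTree E), ∏ e ∈ T'ᶜ, y e
        ≤ ∑ T' ∈ univ.filter (IsSpanningTree E), ∏ e ∈ Tᶜ, y e := Finset.sum_le_sum hmaj
      _ = _ := by rw [Finset.sum_const, nsmul_eq_mul]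
  have hΨpos : 0 < kirchhoffEval E y := by
    obtain ⟨T₀, hT₀⟩ := exists_isSpanningTree E hc
    rw [kirchhoffEval_eq_sum_spanningTrees]
    refine lt_of_lt_of_le (prod_pos fun e _ => hy e : 0 < ∏ e ∈ T₀ᶜ, y e) ?_
    exact Finset.single_le_sum (f := fun T' => ∏ e ∈ T'ᶜ, y e)
      (fun T' _ => Finset.prod_nonneg fun e _ => (hy e).le) ((Finset.mem_filter_univ _).2 hT₀)
  -- the exponents: `D(k+1) - D k - 1 = 0` on `T`, `-2` off `T`
  have hexp : ∀ k : Fin N, D ((k : ℕ) + 1) - D k - 1 = if k ∈ T then 0 else -2 := by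
    intro k
    have hk := k.isLt
    have hr : edgeRank E (univ.filter fun i : Fin N => (i : ℕ) < (k : ℕ) + 1) =
        edgeRank E (univ.filter fun i : Fin N => (i : ℕ) < k) + (if k ∈ T then 1 else 0) := by
      rw [← hcount, ← hcount, ltFilter_succ hk]
      by_cases hkT : k ∈ T
      · rw [if_pos hkT, Finset.inter_insert_of_mem hkT, Finset.card_insert_of_notMem]
        exact fun h => not_mem_ltFilter_self hk (Finset.mem_inter.1 h).2
      · rw [if_neg hkT, Finset.inter_insert_of_notMem hkT, add_zero]
    have hle1 := edgeRank_le_card E (univ.filter fun i : Fin N => (i : ℕ) < (k : ℕ) + 1)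
    have hle0 := edgeRank_le_card E (univ.filter fun i : Fin N => (i : ℕ) < k)
    rw [card_ltFilter (by omega)] at hle1
    rw [card_ltFilter (by omega)] at hle0
    rw [hD, hD, loopNumber, loopNumber, card_ltFilter (by omega), card_ltFilter (by omega), hr,
      Nat.cast_sub (by split_ifs <;> omega), Nat.cast_sub hle0]
    push_cast
    split_ifs <;> ring
  -- the product is `1 / (Π_{e∉T} y_e)²`
  have hprod : ∏ k : Fin N, y k ^ (D ((k : ℕ) + 1) - D k - 1) = 1 / (∏ e ∈ Tᶜ, y e) ^ 2 := by
    have hT1 : ∏ k ∈ T, y k ^ (D ((k : ℕ) + 1) - D k - 1) = 1 :=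
      Finset.prod_eq_one fun k hk => by rw [hexp k, if_pos hk, Real.rpow_zero]
    have hTc : ∏ k ∈ Tᶜ, y k ^ (D ((k : ℕ) + 1) - D k - 1) = ∏ k ∈ Tᶜ, y k ^ (-2 : ℝ) :=
      Finset.prod_congr rfl fun k hk => by rw [hexp k, if_neg (Finset.mem_compl.1 hk)]
    rw [← Finset.prod_mul_prod_compl T (fun k : Fin N => y k ^ (D ((k : ℕ) + 1) - D k - 1)),
      hT1, hTc, one_mul, Real.finsetProd_rpow _ _ (fun e _ => (hy e).le), Real.rpow_neg hP.le,
      Real.rpow_two, one_div]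
  rw [hprod, div_le_div_iff₀ (pow_pos hP 2) (pow_pos hΨpos 2), one_mul]
  calc kirchhoffEval E y ^ 2
      ≤ (((univ.filter (IsSpanningTree E)).card : ℝ) * ∏ e ∈ Tᶜ, y e) ^ 2 :=
        pow_le_pow_left₀ hΨpos.le hΨle 2
    _ = _ := mul_pow _ _ 2

open scoped Classical in
/-- **`Ψ ≤ |ST_G| · Ψ^trop` along an arbitrary ordering**: for positive weights `y` and a
permutation `σ` with `y ∘ σ` monotone, `Π_k y_{σ k}^{D(k+1) - D(k) - 1} ≤ |ST_E|² / Ψ_E(y)²` with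
`D j = j - 2 h₁(σ(first j positions))` (the sorted case for `E ∘ σ`). [cite: Panzer2022, §1 eq. (1.6) (Ψ_G ≤ Ψ^trop_G · |ST_G|) with §2.2 eq. (∗)] -/
theorem prod_rpow_le_card_sq_div_sq_kirchhoffEval
    (E : Fin N → Fin (V + 1) × Fin (V + 1))
    (hc : IsConnectedEdgeList E) (y : Fin N → ℝ) (hy : ∀ e, 0 < y e) (σ : Equiv.Perm (Fin N))
    (hmono : Monotone (y ∘ σ)) (D : ℕ → ℝ)
    (hD : ∀ j, D j = (j : ℝ) - 2 * (loopNumber E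
      ((univ.filter fun i : Fin N => (i : ℕ) < j).map σ.toEmbedding) : ℝ)) :
    ∏ k : Fin N, y (σ k) ^ (D ((k : ℕ) + 1) - D k - 1) ≤
      ((univ.filter (IsSpanningTree E)).card : ℝ) ^ 2 / kirchhoffEval E y ^ 2 := by
  have h := prod_rpow_le_card_sq_div_sq_kirchhoffEval_sorted (E ∘ σ)
    (isConnectedEdgeList_comp_perm E σ hc) (y ∘ σ) (fun e => hy _) hmono D
    (fun j => by rw [hD, loopNumber_comp_perm])
  rwa [kirchhoffEval_comp_perm, card_filter_isSpanningTree_comp_perm] at h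

open scoped Classical in
/-- **`Ψ^trop_G ≤ Ψ_G ≤ Ψ^trop_G · |ST_G|`, sorted case, with the tropical maximum attained by
Kruskal's tree.** For a connected edge list and positive weights sorted along the labelling there is a
spanning tree `T` (the greedy tree of `exists_greedy_isSpanningTree`) whose co-tree monomial `Π_{e∉T} y_e`
dominates that of every spanning tree (so it IS `Ψ^trop_G(y) = max_{T'} Π_{e∉T'} y_e`, §2.2 eq. (∗)),
and `Π_{e∉T} y_e ≤ Ψ_G(y) ≤ |ST_G| · Π_{e∉T} y_e`. [cite: Panzer2022, §1 text before eq. (1.6) (Ψ^trop_G ≤ Ψ_G ≤ Ψ^trop_G · |ST_G|) and §2.2 eq. (∗), Lemma 2.8] -/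
theorem exists_isSpanningTree_dominating_sorted
    (E : Fin N → Fin (V + 1) × Fin (V + 1))
    (hc : IsConnectedEdgeList E) (y : Fin N → ℝ) (hy : ∀ e, 0 < y e) (hmono : Monotone y) :
    ∃ T : Finset (Fin N), IsSpanningTree E T ∧
      (∀ T', IsSpanningTree E T' → ∏ e ∈ T'ᶜ, y e ≤ ∏ e ∈ Tᶜ, y e) ∧
      ∏ e ∈ Tᶜ, y e ≤ kirchhoffEval E y ∧
      kirchhoffEval E y ≤ ((univ.filter (IsSpanningTree E)).card : ℝ) * ∏ e ∈ Tᶜ, y e := by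
  classical
  obtain ⟨T, hT, hcount⟩ := exists_greedy_isSpanningTree E hc
  have hmaj : ∀ T', IsSpanningTree E T' → ∏ e ∈ T'ᶜ, y e ≤ ∏ e ∈ Tᶜ, y e := fun T' hT' =>
    hT'.prod_compl_le_of_greedy hT.1 hcount y hy hmono
  refine ⟨T, hT, hmaj, ?_, ?_⟩
  · rw [kirchhoffEval_eq_sum_spanningTrees]
    exact Finset.single_le_sum (f := fun T' => ∏ e ∈ T'ᶜ, y e)
      (fun T' _ => Finset.prod_nonneg fun e _ => (hy e).le) ((Finset.mem_filter_univ _).2 hT)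
  · rw [kirchhoffEval_eq_sum_spanningTrees]
    calc ∑ T' ∈ univ.filter (IsSpanningTree E), ∏ e ∈ T'ᶜ, y e
        ≤ ∑ T' ∈ univ.filter (IsSpanningTree E), ∏ e ∈ Tᶜ, y e :=
          Finset.sum_le_sum fun T' hT' => hmaj T' ((Finset.mem_filter_univ _).1 hT')
      _ = _ := by rw [Finset.sum_const, nsmul_eq_mul]

/-- **Eq. (∗): on a Hepp sector, `Ψ^trop_G` is ONE monomial, the co-tree monomial of Kruskal's tree.**
For a connected edge list and an ordering `σ` of its edges there is a spanning tree `T_σ` — depending on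
`σ` only — with `Ψ^tr_E(y) = Π_{e∉T_σ} y_e` for EVERY positive weight vector `y` sorted along `σ`
(`y ∘ σ` monotone, the closed sector `H_σ`); here `Ψ^tr` is Borinsky's `trop` of the tree's
`kirchhoffPolynomial ℝ E` (`MatrixTreeTheorem.lean`, § Tropical). [cite: Panzer2022, §2.2 eq. (∗) and Lemma 2.8 (chunk p0007:L64–L76); Borinsky2020, Definition 6] -/
theorem exists_isSpanningTree_trop_eq_prod_compl (E : Fin N → Fin (V + 1) × Fin (V + 1))
    (hc : IsConnectedEdgeList E) (σ : Equiv.Perm (Fin N)) :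
    ∃ T : Finset (Fin N), IsSpanningTree E T ∧ ∀ y : Fin N → ℝ, (∀ e, 0 < y e) → Monotone (y ∘ σ) →
      Borinsky2020.trop (kirchhoffPolynomial ℝ E) y = ∏ e ∈ Tᶜ, y e := by
  obtain ⟨T₀, hT₀, hcount⟩ := exists_greedy_isSpanningTree (E ∘ σ) (isConnectedEdgeList_comp_perm E σ hc)
  refine ⟨T₀.map σ.toEmbedding, (isSpanningTree_comp_perm E σ T₀).1 hT₀, fun y hy hmono => ?_⟩
  -- every spanning tree of `E` is dominated by `T₀.map σ` on the sector
  have hmaj : ∀ T', IsSpanningTree E T' → ∏ e ∈ T'ᶜ, y e ≤ ∏ e ∈ (T₀.map σ.toEmbedding)ᶜ, y e := by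
    intro T' hT'
    have hT'σ : IsSpanningTree (E ∘ σ) (T'.map σ.symm.toEmbedding) := by
      rw [isSpanningTree_comp_perm, Finset.map_map]
      convert hT'
      ext e
      simp
    have h := hT'σ.prod_compl_le_of_greedy hT₀.1 hcount (y ∘ σ) (fun e => hy _) hmono
    simp only [Function.comp_apply] at h
    rw [← prod_compl_map_perm σ, ← prod_compl_map_perm σ, Finset.map_map] at h
    convert h using 3
    ext e
    simp
  refine le_antisymm ?_ (prod_compl_le_trop_kirchhoffPolynomial E
    ((isSpanningTree_comp_perm E σ T₀).1 hT₀) y)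
  obtain ⟨T₁, hT₁, h₁⟩ := exists_isSpanningTree_prod_compl_eq_trop E hc y
  rw [← h₁]
  exact hmaj T₁ hT₁

open scoped Classical in
/-- **`Ψ^trop_G ≤ Ψ_G ≤ Ψ^trop_G · |ST_G|`** (the inequality underlying eq. (1.6)): for a connected
edge list and ANY positive weights `y` there is a spanning tree `T` whose co-tree monomial dominates
that of every spanning tree — `Π_{e∉T} y_e = Ψ^trop_G(y) = max_{T'} Π_{e∉T'} y_e` — and
`Π_{e∉T} y_e ≤ Ψ_G(y) ≤ |ST_G| · Π_{e∉T} y_e` (sort the weights, `Tuple.sort`, and relabel).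
[cite: Panzer2022, §1 text before eq. (1.6) (Ψ^trop_G ≤ Ψ_G ≤ Ψ^trop_G · |ST_G|), eq. (1.4) and §2.2 eq. (∗)] -/
theorem exists_isSpanningTree_dominating
    (E : Fin N → Fin (V + 1) × Fin (V + 1))
    (hc : IsConnectedEdgeList E) (y : Fin N → ℝ) (hy : ∀ e, 0 < y e) :
    ∃ T : Finset (Fin N), IsSpanningTree E T ∧
      (∀ T', IsSpanningTree E T' → ∏ e ∈ T'ᶜ, y e ≤ ∏ e ∈ Tᶜ, y e) ∧
      ∏ e ∈ Tᶜ, y e ≤ kirchhoffEval E y ∧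
      kirchhoffEval E y ≤ ((univ.filter (IsSpanningTree E)).card : ℝ) * ∏ e ∈ Tᶜ, y e := by
  set σ : Equiv.Perm (Fin N) := Tuple.sort y with hσ
  obtain ⟨T₀, hT₀, hmaj₀, hlow₀, hup₀⟩ := exists_isSpanningTree_dominating_sorted (E ∘ σ)
    (isConnectedEdgeList_comp_perm E σ hc) (y ∘ σ) (fun e => hy _) (Tuple.monotone_sort y)
  rw [kirchhoffEval_comp_perm] at hlow₀ hup₀
  rw [card_filter_isSpanningTree_comp_perm] at hup₀
  refine ⟨T₀.map σ.toEmbedding, (isSpanningTree_comp_perm E σ T₀).1 hT₀, fun T' hT' => ?_, ?_, ?_⟩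
  · have hT'σ : IsSpanningTree (E ∘ σ) (T'.map σ.symm.toEmbedding) := by
      rw [isSpanningTree_comp_perm, Finset.map_map]
      convert hT'
      ext e
      simp
    have h := hmaj₀ _ hT'σ
    simp only [Function.comp_apply] at h
    rw [← prod_compl_map_perm σ, ← prod_compl_map_perm σ, Finset.map_map] at h
    convert h using 3
    ext e
    simp
  · rwa [prod_compl_map_perm]
  · rwa [prod_compl_map_perm]

end Trop

/-! ### One ordering: the reverse pointwise bound on the sorting sector -/

section Sector

variable {n V : ℕ} (E : Fin (n + 1) → Fin (V + 1) × Fin (V + 1)) (l : List (Fin (n + 1)))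
  {m : ℕ} {c : ℕ → Fin n} {d : ℕ → ℝ} {sv : (Fin n → ℝ) → ℕ → ℝ}
  {L U : ℕ → (Fin n → ℝ) → ℝ≥0∞}

open scoped Classical in
/-- **The reverse pointwise bound on the sector of the sorting ordering.** For `x` in the open
orthant, `y = (x, 1)` and the ordering `l = [σ 0, …, σ n]` of the permutation `σ` sorting `y`, the
sector function `L 0 x · U n x` of `l` is at most `|ST_E|² / Ψ_E(x,1)²` (the indicator constraints
hold by monotonicity of `y ∘ σ`; the monomial bound is `prod_rpow_le_card_sq_div_sq_kirchhoffEval`,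
i.e. `Ψ ≤ |ST| · Ψ^trop`). [cite: Panzer2022, §1 eq. (1.6) (lower half) and §2.2 eq. (∗)] -/
theorem sector_le_ofReal_card_sq_mul_graphPeriodIntegrand
    (hcE : IsConnectedEdgeList E)
    (hn : 0 < n) (x : Fin n → ℝ) (hx : x ∈ openOrthant n)
    (hlσ : l = List.ofFn ⇑(Tuple.sort (Fin.snoc x (1 : ℝ) : Fin (n + 1) → ℝ)))
    (hm : m = l.idxOf (Fin.last n))
    (hc : ∀ k, (c k : ℕ) = min (l.getD k (Fin.last n) : ℕ) (n - 1))
    (hd : ∀ k, d k = (k : ℝ) - 2 * (loopNumber E (l.take k).toFinset : ℝ))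
    (hsv : ∀ x k, sv x k = if k = m then 1 else x (c k))
    (hL : ∀ i x, L i x = {x | 0 < sv x i ∧ ∀ k ∈ Ico i m,
      sv x k ≤ sv x (k + 1) ∧ 0 ≤ sv x k}.indicator 1 x *
        ∏ k ∈ Ico i m, ENNReal.ofReal (sv x k ^ (d (k + 1) - d k - 1)))
    (hU : ∀ j x, U j x = {x | 1 ≤ sv x j ∧ ∀ k ∈ Ico m j,
      sv x k ≤ sv x (k + 1) ∧ 1 ≤ sv x k}.indicator 1 x *
        ∏ k ∈ Ico (m + 1) (j + 1), ENNReal.ofReal (sv x k ^ (d (k + 1) - d k - 1))) :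
    L 0 x * U n x ≤ ENNReal.ofReal
      (((univ.filter (IsSpanningTree E)).card : ℝ) ^ 2 * graphPeriodIntegrand E x) := by
  set y : Fin (n + 1) → ℝ := Fin.snoc x 1 with hydef
  set σ : Equiv.Perm (Fin (n + 1)) := Tuple.sort y with hσ
  have hmono : Monotone (y ∘ σ) := Tuple.monotone_sort y
  have hy : ∀ e, 0 < y e := snoc_pos hx
  have hl : (l : Multiset (Fin (n + 1))) = (univ : Finset (Fin (n + 1))).val := by
    rw [hlσ]; exact coe_ofFn_perm_eq_univ σ
  obtain ⟨hmn, hvm, hvne, hvinj⟩ := positions_of_ordering l hl hm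
  -- position `k` carries the edge `σ k`, and its value is `y (σ k)`
  have hv : ∀ k (hk : k < n + 1), l.getD k (Fin.last n) = σ ⟨k, hk⟩ := by
    intro k hk
    rw [hlσ, List.getD_eq_getElem _ _ (by rw [List.length_ofFn]; exact hk), List.getElem_ofFn]
  have hval : ∀ k (hk : k < n + 1), sv x k = y (σ ⟨k, hk⟩) := by
    intro k hk
    rw [hsv]
    split_ifs with hkm
    · subst hkm
      rw [← hv, hvm, hydef, Fin.snoc_last]
    · have hlt : (l.getD k (Fin.last n) : ℕ) < n := by
        have h1 := (l.getD k (Fin.last n)).isLt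
        have h2 : (l.getD k (Fin.last n) : ℕ) ≠ n := fun h =>
          hvne k hk hkm (Fin.ext (by rw [h, Fin.val_last]))
        omega
      have hck : Fin.castSucc (c k) = σ ⟨k, hk⟩ := by
        rw [← hv k hk]
        apply Fin.ext
        rw [Fin.val_castSucc, hc k]
        omega
      rw [← hck, hydef, Fin.snoc_castSucc]
  have hvalmono : ∀ k k', k ≤ k' → k' < n + 1 → sv x k ≤ sv x k' := by
    intro k k' hkk' hk'
    rw [hval k (by omega), hval k' hk']
    exact hmono (Fin.mk_le_mk.2 hkk')
  have hvalpos : ∀ k, k < n + 1 → 0 < sv x k := fun k hk => by rw [hval k hk]; exact hy _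
  have hval1 : ∀ k, m ≤ k → k < n + 1 → 1 ≤ sv x k := fun k hmk hk => by
    have := hvalmono m k hmk hk
    rwa [sv_self hsv] at this
  -- the indicator constraints hold
  have hmemL : x ∈ {x : Fin n → ℝ | 0 < sv x 0 ∧ ∀ k ∈ Ico 0 m,
      sv x k ≤ sv x (k + 1) ∧ 0 ≤ sv x k} :=
    ⟨hvalpos 0 (by omega), fun k hk => by
      rw [Finset.mem_Ico] at hk
      exact ⟨hvalmono k (k + 1) (by omega) (by omega), (hvalpos k (by omega)).le⟩⟩
  have hmemU : x ∈ {x : Fin n → ℝ | 1 ≤ sv x n ∧ ∀ k ∈ Ico m n,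
      sv x k ≤ sv x (k + 1) ∧ 1 ≤ sv x k} :=
    ⟨hval1 n (by omega) (by omega), fun k hk => by
      rw [Finset.mem_Ico] at hk
      exact ⟨hvalmono k (k + 1) (by omega) (by omega), hval1 k hk.1 (by omega)⟩⟩
  rw [hL, hU, Set.indicator_of_mem hmemL, Set.indicator_of_mem hmemU, Pi.one_apply, one_mul,
    one_mul]
  -- the reverse monomial bound, transported to positions
  have hbound := prod_rpow_le_card_sq_div_sq_kirchhoffEval E hcE y hy σ hmono d
    (fun j => by rw [hd, hlσ, toFinset_take_ofFn])
  have hprod : (∏ k : Fin (n + 1), y (σ k) ^ (d ((k : ℕ) + 1) - d k - 1)) =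
      ∏ k ∈ range (n + 1), sv x k ^ (d (k + 1) - d k - 1) := by
    rw [← Fin.prod_univ_eq_prod_range (fun k => sv x k ^ (d (k + 1) - d k - 1)) (n + 1)]
    exact Finset.prod_congr rfl fun k _ => by rw [hval k k.isLt]
  have hsplit : (∏ k ∈ range (n + 1), ENNReal.ofReal (sv x k ^ (d (k + 1) - d k - 1))) =
      (∏ k ∈ Ico 0 m, ENNReal.ofReal (sv x k ^ (d (k + 1) - d k - 1))) *
        ∏ k ∈ Ico (m + 1) (n + 1), ENNReal.ofReal (sv x k ^ (d (k + 1) - d k - 1)) := by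
    rw [Finset.range_eq_Ico, ← Finset.prod_Ico_consecutive _ (Nat.zero_le m) (by omega : m ≤ n + 1),
      Finset.prod_eq_prod_Ico_succ_bot hmn, sv_self hsv, Real.one_rpow, ENNReal.ofReal_one, one_mul]
  have hint : graphPeriodIntegrand E x = 1 / kirchhoffEval E y ^ 2 := rfl
  calc (∏ k ∈ Ico 0 m, ENNReal.ofReal (sv x k ^ (d (k + 1) - d k - 1))) *
        ∏ k ∈ Ico (m + 1) (n + 1), ENNReal.ofReal (sv x k ^ (d (k + 1) - d k - 1))
      = ∏ k ∈ range (n + 1), ENNReal.ofReal (sv x k ^ (d (k + 1) - d k - 1)) := hsplit.symm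
    _ = ENNReal.ofReal (∏ k ∈ range (n + 1), sv x k ^ (d (k + 1) - d k - 1)) :=
        (ENNReal.ofReal_prod_of_nonneg fun k hk =>
          Real.rpow_nonneg (hvalpos k (Finset.mem_range.1 hk)).le _).symm
    _ ≤ ENNReal.ofReal (((univ.filter (IsSpanningTree E)).card : ℝ) ^ 2 / kirchhoffEval E y ^ 2) := by
        refine ENNReal.ofReal_le_ofReal ?_
        rw [← hprod]
        exact hbound
    _ = _ := by rw [hint, mul_one_div]

end Sector

/-! ### Assembly: `H(G) ≤ |ST_G|² · P(G)` -/

section Assembly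

variable {n V : ℕ}

open scoped Classical in
/-- **The lower half of Panzer's eq. (1.6)**, product form: for a connected primitive-divergent
edge list, `H(G) ≤ |ST_G|² · P(G)`. Proof: `Ψ_G ≤ |ST_G| · Ψ^trop_G` sector by sector
(`sector_le_ofReal_card_sq_mul_graphPeriodIntegrand`); distinct sectors overlap only where two
weights tie, a null set (`volume_setOf_not_injective_snoc`,
`mem_openOrthant_and_eq_ofFn_sort_of_sector_ne_zero`), so the sector integrals `Π_k ω(G^σ_k)⁻¹`
(`lintegral_sector_eq`) add up to `H(G)` (`cast_graphUnitHeppBound`) below `|ST_G|² · ∫ dx/Ψ²`.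
[cite: Panzer2022, §1 eq. (1.6) (lower half, D = 4)] -/
theorem graphUnitHeppBound_le_card_sq_mul_graphPeriod
    (E : Fin (n + 1) → Fin (V + 1) × Fin (V + 1))
    (hcE : IsConnectedEdgeList E) (hp : IsPrimitiveDivergent E) :
    (graphUnitHeppBound E : ℝ) ≤
      ((univ.filter (IsSpanningTree E)).card : ℝ) ^ 2 * graphPeriod E := by
  classical
  have hn : 0 < n := by
    rcases Nat.eq_zero_or_pos n with h | h
    · subst h
      have h1 := hp.1
      omega
    · exact h
  set S : ℝ := ((univ.filter (IsSpanningTree E)).card : ℝ) with hS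
  -- the per-ordering data and the sector function `G l` (as in `Panzer2022_period_le_hepp_holds`)
  set cf : List (Fin (n + 1)) → ℕ → Fin n := fun l k =>
    ⟨min (l.getD k (Fin.last n) : ℕ) (n - 1), by omega⟩ with hcf
  set df : List (Fin (n + 1)) → ℕ → ℝ := fun l k =>
    (k : ℝ) - 2 * (loopNumber E (l.take k).toFinset : ℝ) with hdf
  set svf : List (Fin (n + 1)) → (Fin n → ℝ) → ℕ → ℝ := fun l x k =>
    if k = l.idxOf (Fin.last n) then 1 else x (cf l k) with hsvf
  set Lf : List (Fin (n + 1)) → ℕ → (Fin n → ℝ) → ℝ≥0∞ := fun l i x =>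
    {x | 0 < svf l x i ∧ ∀ k ∈ Ico i (l.idxOf (Fin.last n)),
      svf l x k ≤ svf l x (k + 1) ∧ 0 ≤ svf l x k}.indicator 1 x *
        ∏ k ∈ Ico i (l.idxOf (Fin.last n)),
          ENNReal.ofReal (svf l x k ^ (df l (k + 1) - df l k - 1)) with hLf
  set Uf : List (Fin (n + 1)) → ℕ → (Fin n → ℝ) → ℝ≥0∞ := fun l j x =>
    {x | 1 ≤ svf l x j ∧ ∀ k ∈ Ico (l.idxOf (Fin.last n)) j,
      svf l x k ≤ svf l x (k + 1) ∧ 1 ≤ svf l x k}.indicator 1 x *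
        ∏ k ∈ Ico (l.idxOf (Fin.last n) + 1) (j + 1),
          ENNReal.ofReal (svf l x k ^ (df l (k + 1) - df l k - 1)) with hUf
  set G : List (Fin (n + 1)) → (Fin n → ℝ) → ℝ≥0∞ := fun l x => Lf l 0 x * Uf l n x with hG
  -- the integral of each sector function
  have hint : ∀ l ∈ orderings (univ : Finset (Fin (n + 1))),
      ∫⁻ x, G l x = ENNReal.ofReal (∏ k ∈ Ico 1 (n + 1), (df l k)⁻¹) := fun l hl =>
    lintegral_sector_eq E l hp hn (mem_orderings_iff.1 hl) (m := l.idxOf (Fin.last n))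
      (c := cf l) (d := df l) (sv := svf l) (L := Lf l) (U := Uf l) rfl (fun _ => rfl)
      (fun _ => rfl) (fun _ _ => rfl) (fun _ _ => rfl) (fun _ _ => rfl)
  have hmeasG : ∀ l, Measurable (G l) := fun l =>
    (measurable_lower (m := l.idxOf (Fin.last n)) (c := cf l) (d := df l) (sv := svf l)
        (L := Lf l) (fun _ _ => rfl) (fun _ _ => rfl) 0).mul
      (measurable_upper (m := l.idxOf (Fin.last n)) (c := cf l) (d := df l) (sv := svf l)
        (U := Uf l) (fun _ _ => rfl) (fun _ _ => rfl) n)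
  -- off the null set of ties, only the sorting sector contributes, and it is bounded
  have hae : ∀ᵐ x, ∑ l ∈ orderings (univ : Finset (Fin (n + 1))), G l x ≤
      (openOrthant n).indicator
        (fun x => ENNReal.ofReal (S ^ 2 * graphPeriodIntegrand E x)) x := by
    rw [ae_iff]
    refine measure_mono_null (fun x hx => ?_) (volume_setOf_not_injective_snoc n)
    rw [Set.mem_setOf_eq] at hx ⊢
    intro hinjx
    apply hx
    by_cases hzero : ∀ l ∈ orderings (univ : Finset (Fin (n + 1))), G l x = 0
    · rw [Finset.sum_eq_zero hzero]
      exact zero_le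
    obtain ⟨l₁, hl₁, hne⟩ : ∃ l ∈ orderings (univ : Finset (Fin (n + 1))), G l x ≠ 0 := by
      simpa using hzero
    obtain ⟨hxO, hl₁eq⟩ := mem_openOrthant_and_eq_ofFn_sort_of_sector_ne_zero l₁
      (mem_orderings_iff.1 hl₁) (m := l₁.idxOf (Fin.last n)) (c := cf l₁) (d := df l₁)
      (sv := svf l₁) (L := Lf l₁) (U := Uf l₁) rfl (fun _ => rfl) (fun _ _ => rfl)
      (fun _ _ => rfl) (fun _ _ => rfl) x hne hinjx
    have hsum : ∑ l ∈ orderings (univ : Finset (Fin (n + 1))), G l x = G l₁ x := by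
      refine Finset.sum_eq_single_of_mem l₁ hl₁ fun l hl hll₁ => ?_
      by_contra hGl
      obtain ⟨-, hleq⟩ := mem_openOrthant_and_eq_ofFn_sort_of_sector_ne_zero l
        (mem_orderings_iff.1 hl) (m := l.idxOf (Fin.last n)) (c := cf l) (d := df l)
        (sv := svf l) (L := Lf l) (U := Uf l) rfl (fun _ => rfl) (fun _ _ => rfl)
        (fun _ _ => rfl) (fun _ _ => rfl) x hGl hinjx
      exact hll₁ (hleq.trans hl₁eq.symm)
    rw [hsum, Set.indicator_of_mem hxO]
    exact sector_le_ofReal_card_sq_mul_graphPeriodIntegrand E l₁ hcE hn x hxO hl₁eq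
      (m := l₁.idxOf (Fin.last n))
      (c := cf l₁) (d := df l₁) (sv := svf l₁) (L := Lf l₁) (U := Uf l₁) rfl (fun _ => rfl)
      (fun _ => rfl) (fun _ _ => rfl) (fun _ _ => rfl) (fun _ _ => rfl)
  -- the Hepp bound is the sum of the sector values
  have hH : ((graphUnitHeppBound E : ℚ) : ℝ) = ∑ l ∈ orderings (univ : Finset (Fin (n + 1))),
      ∏ k ∈ Ico 1 (n + 1), (df l k)⁻¹ := cast_graphUnitHeppBound E
  have hdpos : ∀ l ∈ orderings (univ : Finset (Fin (n + 1))), ∀ k ∈ Ico 1 (n + 1),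
      0 < df l k := fun l hl k hk =>
    sdc_take_pos E l hp (mem_orderings_iff.1 hl) (Finset.mem_Ico.1 hk).1
      (by have := (Finset.mem_Ico.1 hk).2; omega)
  -- measurability of the orthant
  have hset : openOrthant n = Set.univ.pi fun _ : Fin n => Set.Ioi (0 : ℝ) := by
    ext x
    simp [openOrthant]
  have hmeasO : MeasurableSet (openOrthant n) := by
    rw [hset]
    exact MeasurableSet.univ_pi fun _ => measurableSet_Ioi
  -- the bound on the lower Lebesgue integrals
  have key : ENNReal.ofReal (graphUnitHeppBound E : ℝ) ≤
      ENNReal.ofReal (S ^ 2) * ∫⁻ x in openOrthant n, ENNReal.ofReal (graphPeriodIntegrand E x) :=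
    calc ENNReal.ofReal (graphUnitHeppBound E : ℝ)
        = ENNReal.ofReal (∑ l ∈ orderings (univ : Finset (Fin (n + 1))),
            ∏ k ∈ Ico 1 (n + 1), (df l k)⁻¹) := by rw [hH]
      _ = ∑ l ∈ orderings (univ : Finset (Fin (n + 1))),
            ENNReal.ofReal (∏ k ∈ Ico 1 (n + 1), (df l k)⁻¹) :=
          ENNReal.ofReal_sum_of_nonneg fun l hl => Finset.prod_nonneg fun k hk =>
            inv_nonneg.2 (hdpos l hl k hk).le
      _ = ∑ l ∈ orderings (univ : Finset (Fin (n + 1))), ∫⁻ x, G l x :=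
          (Finset.sum_congr rfl hint).symm
      _ = ∫⁻ x, ∑ l ∈ orderings (univ : Finset (Fin (n + 1))), G l x :=
          (lintegral_finsetSum _ fun l _ => hmeasG l).symm
      _ ≤ ∫⁻ x, (openOrthant n).indicator
            (fun x => ENNReal.ofReal (S ^ 2 * graphPeriodIntegrand E x)) x :=
          lintegral_mono_ae hae
      _ = ∫⁻ x in openOrthant n, ENNReal.ofReal (S ^ 2 * graphPeriodIntegrand E x) :=
          lintegral_indicator hmeasO _
      _ = ∫⁻ x in openOrthant n, ENNReal.ofReal (S ^ 2) *
            ENNReal.ofReal (graphPeriodIntegrand E x) :=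
          lintegral_congr fun x => ENNReal.ofReal_mul (sq_nonneg _)
      _ = ENNReal.ofReal (S ^ 2) * ∫⁻ x in openOrthant n,
            ENNReal.ofReal (graphPeriodIntegrand E x) :=
          lintegral_const_mul _ (measurable_graphPeriodIntegrand E).ennreal_ofReal
  -- from the lower Lebesgue integral to the Bochner integral (absolute convergence of the period)
  obtain ⟨-, hInt⟩ := graphPeriod_convergent_of_isPrimitiveDivergent_holds E hcE hp
  have hnn : ∀ x, 0 ≤ graphPeriodIntegrand E x := fun x => by
    unfold graphPeriodIntegrand; positivity
  have hPeq : ENNReal.ofReal (graphPeriod E) =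
      ∫⁻ x in openOrthant n, ENNReal.ofReal (graphPeriodIntegrand E x) :=
    ofReal_integral_eq_lintegral_ofReal hInt (ae_of_all _ hnn)
  have hPnn : 0 ≤ graphPeriod E := integral_nonneg hnn
  rw [← hPeq, ← ENNReal.ofReal_mul (sq_nonneg _)] at key
  exact (ENNReal.ofReal_le_ofReal_iff (mul_nonneg (sq_nonneg _) hPnn)).1 key

open scoped Classical in
/-- **The lower half of Panzer's eq. (1.6)** as printed (`D = 4`): for a connected
primitive-divergent edge list, `H(G) · |ST_G|^{-2} ≤ P(G)` — the Hepp bound divided by the squared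
number of spanning trees is a LOWER bound for the period (the upper half `P(G) ≤ H(G)` is
`Panzer2022_period_le_hepp_holds`). [cite: Panzer2022, §1 eq. (1.6) (lower half, D = 4)] -/
theorem graphUnitHeppBound_div_card_sq_le_graphPeriod
    (E : Fin (n + 1) → Fin (V + 1) × Fin (V + 1))
    (hcE : IsConnectedEdgeList E) (hp : IsPrimitiveDivergent E) :
    (graphUnitHeppBound E : ℝ) / ((univ.filter (IsSpanningTree E)).card : ℝ) ^ 2 ≤
      graphPeriod E := by
  have hS : 0 < ((univ.filter (IsSpanningTree E)).card : ℝ) := by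
    obtain ⟨T, hT⟩ := exists_isSpanningTree E hcE
    exact_mod_cast Finset.card_pos.2 ⟨T, (Finset.mem_filter_univ _).2 hT⟩
  rw [div_le_iff₀ (pow_pos hS 2), mul_comm]
  exact graphUnitHeppBound_le_card_sq_mul_graphPeriod E hcE hp

open scoped Classical in
/-- **Panzer's eq. (1.6), both halves (`D = 4`):** for a connected primitive-divergent edge list,
`H(G) · |ST_G|^{-2} ≤ P(G) ≤ H(G)` — this file's lower half together with the tree's upper half
`Panzer2022_period_le_hepp_holds`. [cite: Panzer2022, §1 eq. (1.6)] -/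
theorem graphPeriod_mem_Icc (E : Fin (n + 1) → Fin (V + 1) × Fin (V + 1))
    (hcE : IsConnectedEdgeList E) (hp : IsPrimitiveDivergent E) :
    graphPeriod E ∈ Set.Icc
      ((graphUnitHeppBound E : ℝ) / ((univ.filter (IsSpanningTree E)).card : ℝ) ^ 2)
      (graphUnitHeppBound E : ℝ) :=
  ⟨graphUnitHeppBound_div_card_sq_le_graphPeriod E hcE hp, Panzer2022_period_le_hepp_holds E hcE hp⟩

/-- **The Hepp bound of a primitive-divergent edge list is positive**: `H(G) = Σ_σ Π_k ω(G^σ_k)⁻¹` is a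
non-empty sum of products of positive numbers (`ω(G^σ_k) > 0` by primitive divergence, `sdc_take_pos`;
Panzer: the Hepp bound is the integral (1.5) of a positive function, a positive rational number).
[cite: Panzer2022, §1 eq. (1.5) and Def. 2.4] -/
theorem graphUnitHeppBound_pos (E : Fin (n + 1) → Fin (V + 1) × Fin (V + 1))
    (hp : IsPrimitiveDivergent E) : 0 < graphUnitHeppBound E := by
  have h : (0 : ℝ) < ((graphUnitHeppBound E : ℚ) : ℝ) := by
    rw [cast_graphUnitHeppBound]
    refine Finset.sum_pos (fun l hl => Finset.prod_pos fun k hk => inv_pos.2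
      (sdc_take_pos E l hp (mem_orderings_iff.1 hl) (Finset.mem_Ico.1 hk).1
        (by have := (Finset.mem_Ico.1 hk).2; omega))) ?_
    exact ⟨List.ofFn ⇑(Equiv.refl (Fin (n + 1))), mem_orderings_iff.2 (coe_ofFn_perm_eq_univ _)⟩
  exact_mod_cast h

open scoped Classical in
/-- **The period of a connected primitive-divergent edge list is positive**: `P(G) ≥ H(G)/|ST_G|² > 0`
(eq. (1.6), lower half, with `H(G) > 0`). [cite: Panzer2022, §1 eq. (1.6)] -/
theorem graphPeriod_pos (E : Fin (n + 1) → Fin (V + 1) × Fin (V + 1))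
    (hcE : IsConnectedEdgeList E) (hp : IsPrimitiveDivergent E) : 0 < graphPeriod E := by
  have hS : 0 < ((univ.filter (IsSpanningTree E)).card : ℝ) := by
    obtain ⟨T, hT⟩ := exists_isSpanningTree E hcE
    exact_mod_cast Finset.card_pos.2 ⟨T, (Finset.mem_filter_univ _).2 hT⟩
  have hH : (0 : ℝ) < (graphUnitHeppBound E : ℝ) := by exact_mod_cast graphUnitHeppBound_pos E hp
  exact lt_of_lt_of_le (div_pos hH (pow_pos hS 2)) (graphUnitHeppBound_div_card_sq_le_graphPeriod E hcE hp)

end Assembly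

end Literature.MathematicalPhysics.QuantumFieldTheory
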